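import Literature.AlgebraicGeometry.HodgeTheory.DirectImageCovering
import HarnessLib

/-!
# Crux `WeilTenfoldsSqrtMinus11` (stmt-HodgeConjecture-1262), line `quaternionic-norm-anchors`
# (skeleton v2, "tensor-anchor reshape") — stub `stub_sectionSmul`

Infrastructure for the Perry-route composition of the line: Perry's theorem
(`HodgeTheory.Perry2026_semiregular_remainsAlgebraic`) consumes CONTINUOUS sections
`s ↦ (s, w_k(s))` of the étalé spaces `FiberClass π (2k)` of `R^{2k} π_* ℂ` (`HodgeTheory/HodgeLocus`),
and the composition feeds it `w_5 = r • σ` for the continuous Weil section `σ` delivered by Deligne's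
Weil-family fact. This file proves that fibrewise scalar multiples of continuous sections of
`FiberClass f k → S(ℂ)` are continuous: the fibrewise map `(t, α) ↦ (t, r·α)` is continuous for the
final topology `FiberClass.instTopologicalSpace` because it carries the local section `tubeSection f k U ξ`
of a tube class `ξ` to the local section of `r·ξ` (`fiberRestrict` is linear).
-/

noncomputable section

set_option linter.dupNamespace false

open CategoryTheory AlgebraicGeometry
open Literature.AlgebraicGeometry Literature.AlgebraicGeometry.Motives Literature.AlgebraicGeometry.HodgeTheory
open Literature.AlgebraicTopology.SingularHomology

namespace Summit.HodgeConjecture.HodgeConjecture.Theorems.HeckePrymWeil.TensorAnchor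

/-- The fibrewise scalar multiplication `(t, α) ↦ (t, r·α)` on the étalé space `FiberClass f k` carries
the local section of a tube class `ξ` over `U` to the local section of `r·ξ` (linearity of restriction
to the fibre). [folklore] -/
private theorem smulFiber_comp_tubeSection {𝒳 S : SchemeOver ℂ} (f : 𝒳 ⟶ S) (k : ℕ) (r : ℂ)
    (U : Set (ComplexPoints S)) (ξ : singularCohomology ℂ ℂ (tubeOver f U) k) :
    (fun x : FiberClass f k => (⟨x.pt, r • x.cls⟩ : FiberClass f k)) ∘ tubeSection f k U ξ =
      tubeSection f k U (r • ξ) := by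
  funext t
  show (⟨(t : ComplexPoints S), r • fiberRestrict f t.2 k ξ⟩ : FiberClass f k) =
    ⟨(t : ComplexPoints S), fiberRestrict f t.2 k (r • ξ)⟩
  rw [map_smul]

/-- The fibrewise scalar multiplication `(t, α) ↦ (t, r·α)` is a continuous self-map of the étalé space
`FiberClass f k` (it suffices to test the local sections `tubeSection f k U ξ` defining the final
topology, and those go to local sections). [cite: Hartshorne1977, II Ex. 1.13] -/
private theorem continuous_smulFiber {𝒳 S : SchemeOver ℂ} (f : 𝒳 ⟶ S) (k : ℕ) (r : ℂ) :
    Continuous fun x : FiberClass f k => (⟨x.pt, r • x.cls⟩ : FiberClass f k) := by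
  refine continuous_iSup_dom.2 fun U => continuous_iSup_dom.2 fun ξ => continuous_coinduced_dom.2 ?_
  rw [smulFiber_comp_tubeSection f k r (U : Set (ComplexPoints S)) ξ]
  exact continuous_tubeSection f k U (r • ξ)

/-- **Stub `stub_sectionSmul` (infrastructure)**: for a continuous section `σ` of the étalé space
`FiberClass f k → S(ℂ)` of `Rᵏ f_* ℂ` and a scalar `r`, the fibrewise multiple `s ↦ (s, r·σ(s))` is again
a continuous section. Proof: it is the composite of `σ` with the fibrewise map `(t, α) ↦ (t, r·α)`, which
is continuous for the final topology (`FiberClass.instTopologicalSpace`) because it carries the local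
section of a tube class `ξ` to the local section of `r·ξ` (`fiberRestrict` is linear).
[cite: Hartshorne1977, II Ex. 1.13] -/
theorem stub_sectionSmul :
    ∀ ⦃𝒳 S : SchemeOver ℂ⦄ (f : 𝒳 ⟶ S) (k : ℕ) (r : ℂ) (σ : ComplexPoints S → FiberClass f k)
      (hpt : ∀ s, (σ s).pt = s), Continuous σ →
      Continuous fun s => (⟨s, r • (σ s).clsAt (hpt s)⟩ : FiberClass f k) := by
  intro 𝒳 S f k r σ hpt hσ
  have key : ∀ (x : FiberClass f k) (s : ComplexPoints S) (h : x.pt = s),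
      (⟨s, r • x.clsAt h⟩ : FiberClass f k) = (⟨x.pt, r • x.cls⟩ : FiberClass f k) := by
    rintro ⟨p, c⟩ s h
    cases h
    rfl
  have heq : (fun s => (⟨s, r • (σ s).clsAt (hpt s)⟩ : FiberClass f k)) =
      (fun x : FiberClass f k => (⟨x.pt, r • x.cls⟩ : FiberClass f k)) ∘ σ :=
    funext fun s => key (σ s) s (hpt s)
  rw [heq]
  exact (continuous_smulFiber f k r).comp hσ

end Summit.HodgeConjecture.HodgeConjecture.Theorems.HeckePrymWeil.TensorAnchor

end
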